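import Summits.CriticalPhenomena.PercolationContinuityZ3.Theorems.Transplant.FKDoubleFanWordCellsFreeRays
import HarnessLib

/-!
# Double fans `K₂ ∨ P_{m+1}`: the `∧²V₃` channel is free — an explicit five-facet invariant cone — and with it the generator `BD`;
# the parts condition of every rim word reduces to the 16 core pairs `{AC, 𝟙, R₀(w), R₁(w)}²`

Helper file (`--supports stmt-CriticalPhenomena-4575`), FK sub-lane `prim-bschramm-fk-3` (gen 50); builds on p205010 (kernel theorem, internal
audit signed; external expert review pending).  One definition (`b3Cone`), no named facts, no sorries, default heartbeats; standard axioms.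
Memo `bschramm/prim-bschramm-fk-3/FAR-CROSS-XXV.md` §3.

The letters preserve the splitting `ℝ⁵ = V₃ ⊕ V₂` (`V₃ = ⟨e_u,e_y,e_z⟩`, `V₂ = ⟨e_x,e_v⟩`), hence the three blocks `∧²V₃ = ⟨uy,uz,yz⟩`,
`V₃⊗V₂` (the block of the seed cone) and `∧²V₂ = ⟨xv⟩` of `Biv`, and the pairing `pairH` is block-diagonal.  On the three-dimensional block
`∧²V₃` the polarisation `T_D` acts by `(uy,uz,yz) ↦ (−p·uy + uz − yz, uy − p·uz + yz, (2−q)(uy − uz) + 2yz)`, `T_a = diag(1,0,1)`,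
`T_b = diag(0,1,1)`, and the `W`'s vanish.  **`b3Cone q`** `= {β ∈ ∧²V₃ : yz ≤ 0, uy ≥ 0, uz ≤ 0, uz − uy − yz ≥ 0, (2−q)uz − yz ≥ 0}` is
invariant for every `0 ≤ q ≤ 2` (**`b3Cone_opTD_mem`**: the images of the five facets are `(2−q)g₄ + q g₁`, `g₄ + q g₂`, `g₄ + q g₃`, `0`, `q g₅`;
**`b3Cone_opAC_mem`**, **`b3Cone_opBC_mem`**, **`b3Cone_opE_mem`**, **`b3Cone_rimOp_mem`**, **`b3Cone_opBlocks_mem`**), contains the `∧²V₃`-parts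
`(P_uy, 0, −P_yz)` of every input generator (`P_yz ≥ P_uy`), and pairs `≥ 0` with every target generator
(**`pairH_b3Cone_targetBiv_nonneg`**: `(1−q)²[S_uy·g₅ + (S_yz − S_uy)·g₁]`).  Consequence: the input bivector of `BD` is `e_zv − e_yz ∈ seedCone ⊕
b3Cone`, so the row and the column `BD` of every rim word are free (**`pcell2_rayBD_nonneg`**, **`pcell2_col_rayBD_nonneg`**), and with
`…WordCellsFreeRays` (**`partsOK_of_core16`**) the parts condition of any rim word, for any two-block spoke pattern and any `q ∈ [0,1]`, reduces to
the 16 CORE pairs `(P,S) ∈ {AC, 𝟙, R₀(w), R₁(w)}²` — all the negativity of the polarized cells enters through the input directions `e_uv, e_xy`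
(and their mirrors `e_uv, e_xz` on the target side).
[cite: Grimmett2006, §3.9 eq. (3.94) (pp. 63–64)] [folklore]
-/

noncomputable section

namespace Summit.CriticalPhenomena.PercolationContinuityZ3.Theorems

namespace FK

namespace ThreeApex

/-! ### The invariant cone of the `∧²V₃` channel -/

/-- **The `∧²V₃` cone**: bivectors supported on `uy, uz, yz` with `yz ≤ 0`, `uy ≥ 0`, `uz ≤ 0`, `uz − uy − yz ≥ 0`, `(2−q)uz − yz ≥ 0`.
[folklore] -/
def b3Cone (q : ℝ) : Set Biv :=
  {β | β.ux = 0 ∧ β.uv = 0 ∧ β.xy = 0 ∧ β.xz = 0 ∧ β.xv = 0 ∧ β.yv = 0 ∧ β.zv = 0 ∧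
    β.yz ≤ 0 ∧ 0 ≤ β.uy ∧ β.uz ≤ 0 ∧ 0 ≤ β.uz - β.uy - β.yz ∧ 0 ≤ (2 - q) * β.uz - β.yz}

/-- The bivector `−e_yz` (the `∧²V₃`-part of the input bivector of `BD` and of `𝟙`). [folklore] -/
def bivNegYZ : Biv := ⟨0, 0, 0, 0, 0, 0, 0, -1, 0, 0⟩

section B3

variable {q : ℝ}

/-- `−e_yz ∈ b3Cone q`. [folklore] -/
theorem bivNegYZ_mem_b3Cone (q : ℝ) : bivNegYZ ∈ b3Cone q := by
  simp only [b3Cone, bivNegYZ, Set.mem_setOf_eq]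
  refine ⟨by trivial, by trivial, by trivial, by trivial, by trivial, by trivial, by trivial, by norm_num, le_rfl, le_rfl,
    by norm_num, ?_⟩
  linarith

/-- The zero bivector lies in `b3Cone q`. [folklore] -/
theorem zero_mem_b3Cone (q : ℝ) : (⟨0, 0, 0, 0, 0, 0, 0, 0, 0, 0⟩ : Biv) ∈ b3Cone q := by
  simp only [b3Cone, Set.mem_setOf_eq]
  refine ⟨by trivial, by trivial, by trivial, by trivial, by trivial, by trivial, by trivial, le_rfl, le_rfl, le_rfl,
    by norm_num, by norm_num⟩

/-- `b3Cone q` is closed under sums. [folklore] -/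
theorem b3Cone_add_mem {β γ : Biv} (hβ : β ∈ b3Cone q) (hγ : γ ∈ b3Cone q) : Biv.add β γ ∈ b3Cone q := by
  simp only [b3Cone, Set.mem_setOf_eq] at hβ hγ ⊢
  obtain ⟨a1, a2, a3, a4, a5, a6, a7, a8, a9, a10, a11, a12⟩ := hβ
  obtain ⟨c1, c2, c3, c4, c5, c6, c7, c8, c9, c10, c11, c12⟩ := hγ
  simp only [Biv.add]
  refine ⟨by rw [a1, c1]; ring, by rw [a2, c2]; ring, by rw [a3, c3]; ring, by rw [a4, c4]; ring, by rw [a5, c5]; ring,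
    by rw [a6, c6]; ring, by rw [a7, c7]; ring, by linarith, by linarith, by linarith, by linarith, ?_⟩
  nlinarith

/-- `b3Cone q` is closed under non-negative scalings. [folklore] -/
theorem b3Cone_smul_mem {t : ℝ} (ht : 0 ≤ t) {β : Biv} (hβ : β ∈ b3Cone q) : Biv.smul t β ∈ b3Cone q := by
  simp only [b3Cone, Set.mem_setOf_eq] at hβ ⊢
  obtain ⟨a1, a2, a3, a4, a5, a6, a7, a8, a9, a10, a11, a12⟩ := hβ
  simp only [Biv.smul]
  refine ⟨by rw [a1]; ring, by rw [a2]; ring, by rw [a3]; ring, by rw [a4]; ring, by rw [a5]; ring, by rw [a6]; ring,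
    by rw [a7]; ring, ?_, mul_nonneg ht a9, ?_, ?_, ?_⟩
  · nlinarith [mul_nonneg ht (neg_nonneg.2 a8)]
  · nlinarith [mul_nonneg ht (neg_nonneg.2 a10)]
  · nlinarith [mul_nonneg ht a11]
  · nlinarith [mul_nonneg ht a12]

/-- A Bernstein-type combination of elements of `b3Cone q` lies in `b3Cone q`. [folklore] -/
theorem b3Cone_lin3_mem {a b c : ℝ} (ha : 0 ≤ a) (hb : 0 ≤ b) (hc : 0 ≤ c) {β γ δ : Biv} (hβ : β ∈ b3Cone q) (hγ : γ ∈ b3Cone q)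
    (hδ : δ ∈ b3Cone q) : Biv.lin3 a β b γ c δ ∈ b3Cone q :=
  b3Cone_add_mem (b3Cone_smul_mem ha hβ) (b3Cone_add_mem (b3Cone_smul_mem hb hγ) (b3Cone_smul_mem hc hδ))

/-- **`T_D` maps `b3Cone q` into itself** (`0 ≤ q ≤ 2`): the facet images are `(2−q)g₄ + q g₁`, `g₄ + q g₂`, `g₄ + q g₃`, `0`, `q g₅`.
[folklore] -/
theorem b3Cone_opTD_mem (hq0 : 0 ≤ q) (hq2 : q ≤ 2) {β : Biv} (hβ : β ∈ b3Cone q) : opTD q β ∈ b3Cone q := by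
  simp only [b3Cone, Set.mem_setOf_eq] at hβ ⊢
  obtain ⟨a1, a2, a3, a4, a5, a6, a7, a8, a9, a10, a11, a12⟩ := hβ
  have h2q : 0 ≤ 2 - q := sub_nonneg.2 hq2
  simp only [opTD]
  rw [a1, a2, a3, a4, a5, a6, a7]
  refine ⟨by ring, by ring, by ring, by ring, by ring, by ring, by ring, ?_, ?_, ?_, ?_, ?_⟩
  · nlinarith [mul_nonneg h2q a11, mul_nonneg hq0 (neg_nonneg.2 a8)]
  · nlinarith [mul_nonneg hq0 a9]
  · nlinarith [mul_nonneg hq0 (neg_nonneg.2 a10)]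
  · nlinarith
  · nlinarith [mul_nonneg hq0 a12]

/-- `W_D` kills `b3Cone q` (the `D`-form vanishes on `∧²V₃`). [folklore] -/
theorem b3Cone_opWD_mem {β : Biv} (hβ : β ∈ b3Cone q) : opWD q β ∈ b3Cone q := by
  have hβ' := hβ
  simp only [b3Cone, Set.mem_setOf_eq] at hβ'
  obtain ⟨a1, a2, a3, a4, a5, a6, a7, -, -, -, -, -⟩ := hβ'
  have hf : formD q β = 0 := by simp only [formD]; rw [a1, a2, a3, a4, a6, a7]; ring
  have e : opWD q β = (⟨0, 0, 0, 0, 0, 0, 0, 0, 0, 0⟩ : Biv) := by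
    ext <;> simp only [opWD, hf, neg_zero]
  rw [e]; exact zero_mem_b3Cone q

/-- `T_a = diag(1,0,1)` on `∧²V₃` maps `b3Cone q` into itself. [folklore] -/
theorem b3Cone_opTa_mem {β : Biv} (hβ : β ∈ b3Cone q) : opTa β ∈ b3Cone q := by
  simp only [b3Cone, Set.mem_setOf_eq] at hβ ⊢
  obtain ⟨a1, a2, a3, a4, a5, a6, a7, a8, a9, a10, a11, a12⟩ := hβ
  simp only [opTa]
  rw [a2, a3, a5, a6, a7]
  exact ⟨by trivial, by trivial, by trivial, by trivial, by trivial, by ring, by trivial, a8, a9, le_rfl, by linarith,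
    by linarith⟩

/-- `W_a` kills `b3Cone q`. [folklore] -/
theorem b3Cone_opWa_mem {β : Biv} (hβ : β ∈ b3Cone q) : opWa β ∈ b3Cone q := by
  simp only [b3Cone, Set.mem_setOf_eq] at hβ ⊢
  obtain ⟨-, -, -, -, -, a6, -, -, -, -, -, -⟩ := hβ
  simp only [opWa]
  rw [a6]
  exact ⟨by trivial, by trivial, by trivial, by trivial, by trivial, by trivial, by trivial, le_rfl, le_rfl, le_rfl,
    by norm_num, by norm_num⟩

/-- `T_b = diag(0,1,1)` on `∧²V₃` maps `b3Cone q` into itself. [folklore] -/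
theorem b3Cone_opTb_mem {β : Biv} (hβ : β ∈ b3Cone q) : opTb β ∈ b3Cone q := by
  simp only [b3Cone, Set.mem_setOf_eq] at hβ ⊢
  obtain ⟨a1, a2, a3, a4, a5, a6, a7, a8, a9, a10, a11, a12⟩ := hβ
  simp only [opTb]
  rw [a2, a4, a5, a6, a7]
  exact ⟨by trivial, by trivial, by trivial, by trivial, by trivial, by trivial, by ring, a8, le_rfl, a10, by linarith, a12⟩

/-- `W_b` kills `b3Cone q`. [folklore] -/
theorem b3Cone_opWb_mem {β : Biv} (hβ : β ∈ b3Cone q) : opWb β ∈ b3Cone q := by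
  simp only [b3Cone, Set.mem_setOf_eq] at hβ ⊢
  obtain ⟨-, -, -, -, -, -, a7, -, -, -, -, -⟩ := hβ
  simp only [opWb]
  rw [a7]
  exact ⟨by trivial, by trivial, by trivial, by trivial, by trivial, by trivial, by trivial, le_rfl, le_rfl, le_rfl,
    by norm_num, by norm_num⟩

/-- `∧²AC_x` maps `b3Cone q` into itself (`x ∈ [0,1]`). [folklore] -/
theorem b3Cone_opAC_mem {x : ℝ} (hx0 : 0 ≤ x) (hx1 : x ≤ 1) {β : Biv} (hβ : β ∈ b3Cone q) : opAC x β ∈ b3Cone q :=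
  b3Cone_lin3_mem (sq_nonneg _) (mul_nonneg hx0 (sub_nonneg.2 hx1)) (sq_nonneg _) hβ (b3Cone_opTa_mem hβ) (b3Cone_opWa_mem hβ)

/-- `∧²BC_y` maps `b3Cone q` into itself (`y ∈ [0,1]`). [folklore] -/
theorem b3Cone_opBC_mem {y : ℝ} (hy0 : 0 ≤ y) (hy1 : y ≤ 1) {β : Biv} (hβ : β ∈ b3Cone q) : opBC y β ∈ b3Cone q :=
  b3Cone_lin3_mem (sq_nonneg _) (mul_nonneg hy0 (sub_nonneg.2 hy1)) (sq_nonneg _) hβ (b3Cone_opTb_mem hβ) (b3Cone_opWb_mem hβ)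

/-- `∧²E_r` maps `b3Cone q` into itself (`0 ≤ q ≤ 2`, `r ∈ [0,1]`). [folklore] -/
theorem b3Cone_opE_mem (hq0 : 0 ≤ q) (hq2 : q ≤ 2) {r : ℝ} (hr0 : 0 ≤ r) (hr1 : r ≤ 1) {β : Biv} (hβ : β ∈ b3Cone q) :
    opE q r β ∈ b3Cone q :=
  b3Cone_lin3_mem (sq_nonneg _) (mul_nonneg hr0 (sub_nonneg.2 hr1)) (sq_nonneg _) hβ (b3Cone_opTD_mem hq0 hq2 hβ)
    (b3Cone_opWD_mem hβ)

/-- The rim letters map `b3Cone q` into itself (`0 ≤ q ≤ 2`). [folklore] -/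
theorem b3Cone_rimOp_mem (hq0 : 0 ≤ q) (hq2 : q ≤ 2) (k : ℕ) {β : Biv} (hβ : β ∈ b3Cone q) : rimOp q k β ∈ b3Cone q := by
  match k with
  | 0 => exact b3Cone_opWD_mem hβ
  | 1 => exact b3Cone_opTD_mem hq0 hq2 hβ
  | _ + 2 => exact hβ

/-- **Every middle word with unit weights maps `b3Cone q` into itself** (`0 ≤ q ≤ 2`). [folklore] -/
theorem b3Cone_opBlocks_mem (hq0 : 0 ≤ q) (hq2 : q ≤ 2) :
    ∀ (mids : List (ℝ × ℝ × ℝ)), UnitBlocks mids → ∀ {β : Biv}, β ∈ b3Cone q → opBlocks q mids β ∈ b3Cone q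
  | [], _, _, hβ => hβ
  | blk :: rest, hm, β, hβ => by
    have h := hm blk (List.mem_cons.2 (Or.inl rfl))
    exact b3Cone_opBlocks_mem hq0 hq2 rest (fun b hb => hm b (List.mem_cons.2 (Or.inr hb)))
      (b3Cone_opAC_mem h.2.2.1 h.2.2.2.1 (b3Cone_opBC_mem h.2.2.2.2.1 h.2.2.2.2.2 (b3Cone_opE_mem hq0 hq2 h.1 h.2.1 hβ)))

/-- **`b3Cone q` pairs `≥ 0` with the target bivector of every parts generator** (`q ≤ 1`):
`⟪β, targetBiv S⟫ = (1−q)²[S_uy·((2−q)β_uz − β_yz) + (S_yz − S_uy)·(−β_yz)]` and `S_yz ≥ S_uy` at the generators. [folklore] -/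
theorem pairH_b3Cone_targetBiv_nonneg (hq1 : q ≤ 1) {β : Biv} (hβ : β ∈ b3Cone q) {S : P6} (hS : IsGenP q S) :
    0 ≤ pairH q β (targetBiv S) := by
  simp only [b3Cone, Set.mem_setOf_eq] at hβ
  obtain ⟨a1, a2, a3, a4, a5, a6, a7, a8, -, -, -, a12⟩ := hβ
  have e : pairH q β (targetBiv S) = (1 - q) ^ 2 * (S.uy * ((2 - q) * β.uz - β.yz) + (S.yz - S.uy) * (-β.yz)) := by
    simp only [pairH, targetBiv, a1, a2, a3, a4, a5, a6, a7]; ring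
  rw [e]
  have hyz : 0 ≤ -β.yz := neg_nonneg.2 a8
  have key : ∀ suy syz : ℝ, 0 ≤ suy → suy ≤ syz → 0 ≤ (1 - q) ^ 2 * (suy * ((2 - q) * β.uz - β.yz) + (syz - suy) * (-β.yz)) :=
    fun suy syz h0 h1 => mul_nonneg (sq_nonneg _) (add_nonneg (mul_nonneg h0 a12) (mul_nonneg (sub_nonneg.2 h1) hyz))
  rcases hS with rfl | rfl | rfl | rfl | rfl | ⟨w, hw0, hw1, rfl | rfl⟩
  · exact key _ _ (by simp [rayA]) (by simp [rayA])
  · exact key _ _ (by simp [rayD]) (by simp [rayD])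
  · exact key _ _ (by simp [rayAC]) (by simp [rayAC])
  · exact key _ _ (by simp [rayBD]) (by simp [rayBD])
  · exact key _ _ (by simp [rayOne]) (by simp [rayOne])
  · exact key _ _ (by simp [roofR0]) (by simp [roofR0])
  · refine key _ _ ?_ ?_
    · simp only [roofR1]; nlinarith [mul_nonneg hw0 (sub_nonneg.2 hw1)]
    · have hz : 0 ≤ zwR q w := by
        simp only [zwR]; nlinarith [mul_nonneg hw0 (sub_nonneg.2 hq1), mul_nonneg hw0 hw0]
      simp only [roofR1]; linarith

/-- **The `∧²V₃` channel is free at every rim distance**: for every middle word with unit weights and last rim weight in `[0,1]`, the image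
of any element of `b3Cone q` pairs `≥ 0` with every target generator (`0 ≤ q ≤ 1`). [folklore] -/
theorem pairH_opBlocks_b3Cone_targetBiv_nonneg (hq0 : 0 ≤ q) (hq1 : q ≤ 1) {mids : List (ℝ × ℝ × ℝ)} (hm : UnitBlocks mids)
    {rd : ℝ} (hrd0 : 0 ≤ rd) (hrd1 : rd ≤ 1) {β : Biv} (hβ : β ∈ b3Cone q) {S : P6} (hS : IsGenP q S) :
    0 ≤ pairH q (opE q rd (opBlocks q mids β)) (targetBiv S) :=
  pairH_b3Cone_targetBiv_nonneg hq1
    (b3Cone_opE_mem hq0 (by linarith) hrd0 hrd1 (b3Cone_opBlocks_mem hq0 (by linarith) mids hm hβ)) hS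

end B3

/-! ### The generator `BD` is free; reduction to the 16 core pairs -/

section BD

variable {q : ℝ} {k0 k1 k2 : ℕ} {x1 y1 x2 y2 : ℝ}

/-- `inputBiv BD = e_zv + (−e_yz)`: a seed plus an element of the `∧²V₃` cone. [folklore] -/
theorem inputBiv_rayBD : inputBiv rayBD = Biv.add bivZV bivNegYZ := by
  ext <;> simp [inputBiv, rayBD, bivZV, bivNegYZ, Biv.add]

/-- **The row `BD` is free**: `pcell2 … BD S ≥ 0` for every rim word, every spoke pattern in `[0,1]⁴`, every target generator and every
`q ∈ [0,1]`. [folklore] -/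
theorem pcell2_rayBD_nonneg (hq0 : 0 ≤ q) (hq1 : q ≤ 1) (hx10 : 0 ≤ x1) (hx11 : x1 ≤ 1) (hy10 : 0 ≤ y1) (hy11 : y1 ≤ 1)
    (hx20 : 0 ≤ x2) (hx21 : x2 ≤ 1) (hy20 : 0 ≤ y2) (hy21 : y2 ≤ 1) {S : P6} (hS : IsGenP q S) :
    0 ≤ pcell2 q k0 k1 k2 x1 y1 x2 y2 rayBD S := by
  have hq2 : q ≤ 2 := by linarith
  unfold pcell2
  rw [inputBiv_rayBD, rimOp_add, opBC_add_biv, opAC_add_biv, rimOp_add, opBC_add_biv, opAC_add_biv, rimOp_add, pairH_add_left]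
  refine add_nonneg ?_ ?_
  · exact pairH_seedCone_targetBiv_nonneg hq0 hq1
      (seedCone_rimOp_mem hq0 k2 (seedCone_opAC_mem hq0 hx20 hx21 (seedCone_opBC_mem hq0 hy20 hy21
        (seedCone_rimOp_mem hq0 k1 (seedCone_opAC_mem hq0 hx10 hx11 (seedCone_opBC_mem hq0 hy10 hy11
          (seedCone_rimOp_mem hq0 k0 (bivZV_mem_seedCone q)))))))) hS
  · exact pairH_b3Cone_targetBiv_nonneg hq1
      (b3Cone_rimOp_mem hq0 hq2 k2 (b3Cone_opAC_mem hx20 hx21 (b3Cone_opBC_mem hy20 hy21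
        (b3Cone_rimOp_mem hq0 hq2 k1 (b3Cone_opAC_mem hx10 hx11 (b3Cone_opBC_mem hy10 hy11
          (b3Cone_rimOp_mem hq0 hq2 k0 (bivNegYZ_mem_b3Cone q)))))))) hS

/-- **The column `BD` is free** (mirror of the row). [folklore] -/
theorem pcell2_col_rayBD_nonneg (hq0 : 0 ≤ q) (hq1 : q ≤ 1) (hx10 : 0 ≤ x1) (hx11 : x1 ≤ 1) (hy10 : 0 ≤ y1) (hy11 : y1 ≤ 1)
    (hx20 : 0 ≤ x2) (hx21 : x2 ≤ 1) (hy20 : 0 ≤ y2) (hy21 : y2 ≤ 1) {P : P6} (hP : IsGenP q P) :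
    0 ≤ pcell2 q k0 k1 k2 x1 y1 x2 y2 P rayBD := by
  rw [pcell2_mirror]
  exact pcell2_rayBD_nonneg hq0 hq1 hy20 hy21 hx20 hx21 hy10 hy11 hx10 hx11 hP

/-- **Reduction to the 16 core pairs**: the parts condition of ANY rim word follows from the pairs `(P,S) ∈ {AC, 𝟙, R₀(w), R₁(w)}²`
(`q ∈ [0,1]`, spokes in `[0,1]`). [folklore] -/
theorem partsOK_of_core16 (hq0 : 0 ≤ q) (hq1 : q ≤ 1) (hx10 : 0 ≤ x1) (hx11 : x1 ≤ 1) (hy10 : 0 ≤ y1) (hy11 : y1 ≤ 1)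
    (hx20 : 0 ≤ x2) (hx21 : x2 ≤ 1) (hy20 : 0 ≤ y2) (hy21 : y2 ≤ 1)
    (h : ∀ P S : P6, IsGenP q P → IsGenP q S → P ≠ rayA → P ≠ rayD → P ≠ rayBD → S ≠ rayA → S ≠ rayD → S ≠ rayBD →
      0 ≤ pcell2 q k0 k1 k2 x1 y1 x2 y2 P S) :
    PartsOK q k0 k1 k2 x1 y1 x2 y2 := by
  refine partsOK_of_core hq0 hq1 hx10 hx11 hy10 hy11 hx20 hx21 hy20 hy21 (fun P S hP hS hPA hPD hSA hSD => ?_)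
  by_cases hPB : P = rayBD
  · subst hPB; exact pcell2_rayBD_nonneg hq0 hq1 hx10 hx11 hy10 hy11 hx20 hx21 hy20 hy21 hS
  by_cases hSB : S = rayBD
  · subst hSB; exact pcell2_col_rayBD_nonneg hq0 hq1 hx10 hx11 hy10 hy11 hx20 hx21 hy20 hy21 hP
  exact h P S hP hS hPA hPD hPB hSA hSD hSB

end BD

end ThreeApex

end FK

end Summit.CriticalPhenomena.PercolationContinuityZ3.Theorems
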